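import Literature.Analysis.FluidPDE.EnergyToolkit
import Literature.Analysis.FluidPDE.TaoEnstrophyLocalisationProofs
import Literature.Analysis.FluidPDE.KatoLocalLeraySlab
import HarnessLib

/-!
# Slice estimates for the cut-off energy identity of the caloric remainder

Analysis/FluidPDE support file (theorems only) on the discharge path of
`Literature.Analysis.FluidPDE.GIP2003_L3_stability` (Gallagher–Iftimie–Planchon 2003, Thm. 0.1 (i)
= Thm. 2.1 in `L³`). In the local energy identity of the caloric remainder `v = u - e`
(`GIP2003.remainder_local_energy_identity`, `GIP2003.remainder_coupling_expansion`) tested with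
the squared cutoff `φ_R = χ_R²` (`χ_R = cutoff R`), every term on the right-hand side is, at a
fixed time, either a *cutoff error* `O(R^{-1/2})` in terms of the `L³` norms of `u`, `v`, `e`, or
is absorbed into the localised dissipation `X = ∫ χ_R² |Dv|²_F`, or is the *source*
`ν⁻¹ ∫ |e|⁴` — the computation of GIP 2003, proof of Thm. 2.1, (8)–Gronwall display p. 1397
("using the fact that `w` is uniformly bounded by `ε₀`" to absorb, Sobolev embedding and
interpolation), here with the caloric background `e` in place of the small solution `w`
(Calderón 1990, §1; Lemarié-Rieusset 2016, proof of Thm. 14.7, p. 516: "`2|⟪∇w(e), e⟫| ≤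
ν|∇w|² + ν⁻¹|e|⁴` is absorbed"). This file proves these slice inequalities in a
`3`-dimensional inner product space `E`:

* tools: the squared cutoff and its gradient (`GIP2003.norm_gradient_cutoff_sq_le`, …), Hölder in
  the forms `∫ |a||b||c| ≤ ‖a‖₃‖b‖₃‖c‖₃` and `∫_{B} |v|² ≤ |B|^{1/3}‖v‖₃²`;
* `GIP2003.abs_transport_term_le`, `GIP2003.abs_coupling_cutoff_terms_le` — the cutoff error
  terms `∫ |v|²⟪w, ∇φ_R⟫`, `2∫⟪v,e⟫⟪v,∇φ_R⟫`, `2∫⟪v,e⟫⟪e,∇φ_R⟫` are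
  `≤ (C/R) · (L³ norms)`;
* `GIP2003.abs_gradient_cutoff_term_le` — `2ν|∫⟪Dv(∇φ_R), v⟫| ≤ (ν/4) X + C ν R⁻¹ ‖v‖₃²`;
* `GIP2003.abs_source_term_le` — `2|∫ φ_R ⟪Dv(e), e⟫| ≤ (ν/4) X + (4/ν) ∫ |e|⁴`;
* `GIP2003.abs_absorbed_term_le` — `2|∫ φ_R ⟪Dv(v), e⟫| ≤ (2√2 K ‖e‖₃ + ν/4) X + C ν⁻¹ R⁻¹ ‖e‖₃²‖v‖₃²`
  with the Gagliardo–Nirenberg–Sobolev constant `K` (`rpow_integral_norm_pow_six_le`).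

## References

* I. Gallagher, D. Iftimie, F. Planchon, Ann. Inst. Fourier 53 (2003), proof of Thm. 2.1,
  (8) and p. 1397. [GallagherIftimiePlanchon2003]
* P. G. Lemarié-Rieusset, *The Navier–Stokes Problem in the 21st Century*, CRC Press 2016,
  proof of Thm. 14.7, p. 516. [LemarieRieusset2016]
* C. P. Calderón, Trans. AMS 318 (1990), §1. [Calderon1990]
-/

noncomputable section

open MeasureTheory TopologicalSpace Set Function Filter Metric InnerProductSpace
open _root_.Topology
open scoped ENNReal NNReal RealInnerProductSpace

namespace Literature.Analysis.FluidPDE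

namespace GIP2003

/-! ### The squared cutoff -/

section Cutoff

variable {E : Type*} [NormedAddCommGroup E] [InnerProductSpace ℝ E]

/-- The squared cutoff `χ_R²` is smooth. [folklore] -/
theorem contDiff_cutoff_sq {n : ℕ∞} (R : ℝ) : ContDiff ℝ n fun x : E => cutoff R x ^ 2 :=
  (contDiff_cutoff R).pow 2

/-- The squared cutoff has compact support (`R > 0`). [folklore] -/
theorem hasCompactSupport_cutoff_sq [FiniteDimensional ℝ E] {R : ℝ} (hR : 0 < R) :
    HasCompactSupport fun x : E => cutoff R x ^ 2 :=
  (hasCompactSupport_cutoff hR).comp_left (g := fun r : ℝ => r ^ 2) (by norm_num)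

/-- `0 ≤ χ_R² ≤ 1`. [folklore] -/
theorem cutoff_sq_nonneg (R : ℝ) (x : E) : 0 ≤ cutoff R x ^ 2 := sq_nonneg _

/-- `χ_R² ≤ 1`. [folklore] -/
theorem cutoff_sq_le_one (R : ℝ) (x : E) : cutoff R x ^ 2 ≤ 1 := by
  have h0 := cutoff_nonneg R x
  have h1 := cutoff_le_one R x
  nlinarith

/-- `χ_R² ≤ χ_R` (since `0 ≤ χ_R ≤ 1`). [folklore] -/
theorem cutoff_sq_le_self (R : ℝ) (x : E) : cutoff R x ^ 2 ≤ cutoff R x := by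
  have h0 := cutoff_nonneg R x
  have h1 := cutoff_le_one R x
  nlinarith

/-- The derivative of the squared cutoff: `D(χ²) = 2χ Dχ`. [folklore] -/
theorem fderiv_cutoff_sq (R : ℝ) (x : E) :
    fderiv ℝ (fun y : E => cutoff R y ^ 2) x = (2 * cutoff R x) • fderiv ℝ (cutoff R) x := by
  have hd : DifferentiableAt ℝ (cutoff R) x :=
    ((contDiff_cutoff (n := 1) R).differentiable one_ne_zero x)
  have h := (hd.hasFDerivAt.pow 2)
  rw [h.fderiv]
  simp [pow_one]

/-- The gradient of the squared cutoff: `∇(χ²) = 2χ ∇χ`. [folklore] -/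
theorem gradient_cutoff_sq [FiniteDimensional ℝ E] (R : ℝ) (x : E) :
    gradient (fun y : E => cutoff R y ^ 2) x = (2 * cutoff R x) • gradient (cutoff R) x := by
  rw [gradient, gradient, fderiv_cutoff_sq, map_smul]

/-- `‖∇χ_R(x)‖ = ‖Dχ_R(x)‖`. [folklore] -/
theorem norm_gradient_eq_norm_fderiv [FiniteDimensional ℝ E] (f : E → ℝ) (x : E) :
    ‖gradient f x‖ = ‖fderiv ℝ f x‖ := by
  rw [gradient]
  exact (InnerProductSpace.toDual ℝ E).symm.norm_map _

/-- Far from the origin the cutoff is locally zero, so its derivative vanishes. [folklore] -/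
theorem fderiv_cutoff_eq_zero_of_lt {R : ℝ} (hR : 0 < R) {x : E} (hx : 2 * R < ‖x‖) :
    fderiv ℝ (cutoff R) x = 0 := by
  have hev : (cutoff (E := E) R) =ᶠ[𝓝 x] fun _ => 0 := by
    have hopen : IsOpen {y : E | 2 * R < ‖y‖} := isOpen_lt continuous_const continuous_norm
    filter_upwards [hopen.mem_nhds hx] with y hy
    exact cutoff_eq_zero hR hy.le
  rw [hev.fderiv_eq, fderiv_fun_const, Pi.zero_apply]

/-- Pointwise: `‖Dχ_R(x)‖ ≤ (C₁/R) 1_{B̄(0,2R)}(x)`. [folklore] -/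
theorem norm_fderiv_cutoff_le_indicator {R C₁ : ℝ} (hR : 0 < R)
    (hC₁ : ∀ x : E, ‖fderiv ℝ (cutoff R) x‖ ≤ C₁ / R) (x : E) :
    ‖fderiv ℝ (cutoff R) x‖ ≤ C₁ / R * (closedBall (0 : E) (2 * R)).indicator (fun _ => (1 : ℝ)) x := by
  by_cases hx : x ∈ closedBall (0 : E) (2 * R)
  · rw [indicator_of_mem hx, mul_one]; exact hC₁ x
  · rw [mem_closedBall_zero_iff, not_le] at hx
    rw [fderiv_cutoff_eq_zero_of_lt hR hx, norm_zero]
    exact mul_nonneg (le_trans (norm_nonneg _) (hC₁ 0)) (indicator_nonneg (fun _ _ => zero_le_one) _)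

end Cutoff

/-! ### Hölder tools -/

section Holder

variable {α : Type*} [MeasurableSpace α] {μ : Measure α}

/-- **Three-factor Hölder**: `∫ |a| |b| |c| ≤ ‖a‖₃ ‖b‖₃ ‖c‖₃`. [folklore] -/
theorem lintegral_enorm_mul_mul_le {G₁ G₂ G₃ : Type*} [NormedAddCommGroup G₁]
    [NormedAddCommGroup G₂] [NormedAddCommGroup G₃] {a : α → G₁} {b : α → G₂} {c : α → G₃}
    (ha : AEStronglyMeasurable a μ) (hb : AEStronglyMeasurable b μ)
    (hc : AEStronglyMeasurable c μ) :
    ∫⁻ x, ‖a x‖ₑ * ‖b x‖ₑ * ‖c x‖ₑ ∂μ ≤ eLpNorm a 3 μ * eLpNorm b 3 μ * eLpNorm c 3 μ := by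
  haveI : ENNReal.HolderTriple 3 3 (3 / 2) := by
    constructor
    rw [ENNReal.inv_div (Or.inr (by norm_num)) (Or.inr (by norm_num)), ← two_mul, div_eq_mul_inv]
  haveI : ENNReal.HolderTriple (3 / 2) 3 1 := by
    refine ⟨?_⟩
    rw [ENNReal.inv_div (Or.inr (by norm_num)) (Or.inr (by norm_num)), inv_one,
      show (3 : ℝ≥0∞)⁻¹ = 1 / 3 by rw [one_div], ENNReal.div_add_div_same,
      show (2 : ℝ≥0∞) + 1 = 3 by norm_num, ENNReal.div_self (by norm_num) (by norm_num)]
  -- `f = |a| |b| ∈ L^{3/2}`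
  have h1 : eLpNorm ((fun x => ‖a x‖) • fun x => ‖b x‖) (3 / 2) μ ≤
      eLpNorm a 3 μ * eLpNorm b 3 μ := by
    have h := eLpNorm_smul_le_mul_eLpNorm (p := 3) (q := 3) (r := 3 / 2) hb.norm ha.norm (μ := μ)
    rwa [eLpNorm_norm, eLpNorm_norm] at h
  have hfm : AEStronglyMeasurable ((fun x => ‖a x‖) • fun x => ‖b x‖) μ := ha.norm.smul hb.norm
  have h2 : eLpNorm (((fun x => ‖a x‖) • fun x => ‖b x‖) • fun x => ‖c x‖) 1 μ ≤
      eLpNorm ((fun x => ‖a x‖) • fun x => ‖b x‖) (3 / 2) μ * eLpNorm c 3 μ := by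
    have h := eLpNorm_smul_le_mul_eLpNorm (p := 3 / 2) (q := 3) (r := 1) hc.norm hfm (μ := μ)
    rwa [eLpNorm_norm] at h
  have heq : ∫⁻ x, ‖a x‖ₑ * ‖b x‖ₑ * ‖c x‖ₑ ∂μ =
      eLpNorm (((fun x => ‖a x‖) • fun x => ‖b x‖) • fun x => ‖c x‖) 1 μ := by
    rw [eLpNorm_one_eq_lintegral_enorm]
    refine lintegral_congr fun x => ?_
    simp only [Pi.smul_apply', Pi.mul_apply, smul_eq_mul, enorm_mul, enorm_norm]
  rw [heq]
  exact h2.trans (mul_le_mul' h1 le_rfl)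

/-- **Three-factor Hölder, real form with a weight**: if `|F| ≤ k |a| |b| |c|` pointwise with
`k ≥ 0` and `a, b, c ∈ L³`, then `|∫ F| ≤ k (‖a‖₃ ‖b‖₃ ‖c‖₃)`. [folklore] -/
theorem abs_integral_le_of_le_mul_three {G₁ G₂ G₃ : Type*} [NormedAddCommGroup G₁]
    [NormedAddCommGroup G₂] [NormedAddCommGroup G₃] {F : α → ℝ} {a : α → G₁} {b : α → G₂}
    {c : α → G₃} {k : ℝ} (hk : 0 ≤ k) (hF : ∀ x, |F x| ≤ k * (‖a x‖ * ‖b x‖ * ‖c x‖))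
    (ha : MemLp a 3 μ) (hb : MemLp b 3 μ) (hc : MemLp c 3 μ) :
    |∫ x, F x ∂μ| ≤ k * (eLpNorm a 3 μ * eLpNorm b 3 μ * eLpNorm c 3 μ).toReal := by
  have hlin := lintegral_enorm_mul_mul_le ha.1 hb.1 hc.1
  have htop : eLpNorm a 3 μ * eLpNorm b 3 μ * eLpNorm c 3 μ ≠ ⊤ :=
    ENNReal.mul_ne_top (ENNReal.mul_ne_top ha.eLpNorm_ne_top hb.eLpNorm_ne_top) hc.eLpNorm_ne_top
  -- the majorant is integrable
  have hmeas : AEStronglyMeasurable (fun x => ‖a x‖ * ‖b x‖ * ‖c x‖) μ :=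
    (ha.1.norm.mul hb.1.norm).mul hc.1.norm
  have hI : Integrable (fun x => ‖a x‖ * ‖b x‖ * ‖c x‖) μ := by
    refine ⟨hmeas, ?_⟩
    have : ∫⁻ x, ‖‖a x‖ * ‖b x‖ * ‖c x‖‖ₑ ∂μ = ∫⁻ x, ‖a x‖ₑ * ‖b x‖ₑ * ‖c x‖ₑ ∂μ :=
      lintegral_congr fun x => by simp only [enorm_mul, enorm_norm]
    rw [hasFiniteIntegral_iff_enorm, this]
    exact hlin.trans_lt (lt_top_iff_ne_top.2 htop)
  have hval : ∫ x, ‖a x‖ * ‖b x‖ * ‖c x‖ ∂μ ≤ (eLpNorm a 3 μ * eLpNorm b 3 μ * eLpNorm c 3 μ).toReal := by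
    rw [integral_eq_lintegral_of_nonneg_ae (Eventually.of_forall fun x => by positivity) hmeas]
    refine ENNReal.toReal_mono htop ?_
    have : ∫⁻ x, ENNReal.ofReal (‖a x‖ * ‖b x‖ * ‖c x‖) ∂μ = ∫⁻ x, ‖a x‖ₑ * ‖b x‖ₑ * ‖c x‖ₑ ∂μ :=
      lintegral_congr fun x => by
        rw [← ofReal_norm, ← ofReal_norm, ← ofReal_norm,
          ← ENNReal.ofReal_mul (norm_nonneg _), ← ENNReal.ofReal_mul (by positivity)]
    rw [this]
    exact hlin
  calc |∫ x, F x ∂μ| ≤ ∫ x, |F x| ∂μ := abs_integral_le_integral_abs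
    _ ≤ ∫ x, k * (‖a x‖ * ‖b x‖ * ‖c x‖) ∂μ :=
        integral_mono_of_nonneg (Eventually.of_forall fun x => abs_nonneg _) (hI.const_mul k)
          (Eventually.of_forall hF)
    _ = k * ∫ x, ‖a x‖ * ‖b x‖ * ‖c x‖ ∂μ := integral_const_mul _ _
    _ ≤ k * (eLpNorm a 3 μ * eLpNorm b 3 μ * eLpNorm c 3 μ).toReal :=
        mul_le_mul_of_nonneg_left hval hk

/-- **Hölder on a set of finite measure**: `∫_s |v|² ≤ (μ s)^{1/3} ‖v‖₃²` (real form; `v ∈ L³`).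
[folklore] -/
theorem setIntegral_norm_sq_le {G : Type*} [NormedAddCommGroup G] {v : α → G} (hv : MemLp v 3 μ)
    {s : Set α} (hμs : μ s ≠ ⊤) :
    ∫ x in s, ‖v x‖ ^ 2 ∂μ ≤ ((μ s) ^ (1 / 3 : ℝ) * eLpNorm v 3 μ ^ 2).toReal := by
  have hvs : AEStronglyMeasurable v (μ.restrict s) := hv.1.restrict
  have h1 := lintegral_enorm_sq_le_rpow_mul_measure v hvs
  rw [Measure.restrict_apply_univ] at h1
  have h3 : (∫⁻ x in s, ‖v x‖ₑ ^ (3 : ℝ) ∂μ) ≤ eLpNorm v 3 μ ^ (3 : ℝ) := by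
    rw [← lintegral_enorm_rpow_three_eq]
    exact lintegral_mono_set (subset_univ _) |>.trans (le_of_eq (setLIntegral_univ _))
  have h4 : (∫⁻ x in s, ‖v x‖ₑ ^ (3 : ℝ) ∂μ) ^ (2 / 3 : ℝ) ≤ eLpNorm v 3 μ ^ 2 := by
    calc (∫⁻ x in s, ‖v x‖ₑ ^ (3 : ℝ) ∂μ) ^ (2 / 3 : ℝ)
        ≤ (eLpNorm v 3 μ ^ (3 : ℝ)) ^ (2 / 3 : ℝ) := ENNReal.rpow_le_rpow h3 (by norm_num)
      _ = eLpNorm v 3 μ ^ 2 := by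
          rw [← ENNReal.rpow_mul, show (3 : ℝ) * (2 / 3) = 2 by norm_num]
          norm_cast
  have hbound : ∫⁻ x in s, ‖v x‖ₑ ^ 2 ∂μ ≤ (μ s) ^ (1 / 3 : ℝ) * eLpNorm v 3 μ ^ 2 :=
    h1.trans (by rw [mul_comm]; exact mul_le_mul' le_rfl h4)
  have htop : (μ s) ^ (1 / 3 : ℝ) * eLpNorm v 3 μ ^ 2 ≠ ⊤ :=
    ENNReal.mul_ne_top (ENNReal.rpow_ne_top_of_nonneg (by norm_num) hμs)
      (ENNReal.pow_ne_top hv.eLpNorm_ne_top)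
  have hm2 : AEStronglyMeasurable (fun x => ‖v x‖ ^ 2) (μ.restrict s) :=
    (hvs.norm.aemeasurable.pow_const 2).aestronglyMeasurable
  rw [integral_eq_lintegral_of_nonneg_ae (Eventually.of_forall fun x => by positivity) hm2]
  refine ENNReal.toReal_mono htop ?_
  have : ∫⁻ x in s, ENNReal.ofReal (‖v x‖ ^ 2) ∂μ = ∫⁻ x in s, ‖v x‖ₑ ^ 2 ∂μ :=
    lintegral_congr fun x => by rw [← ofReal_norm, ENNReal.ofReal_pow (norm_nonneg _)]
  rw [this]
  exact hbound

end Holder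

/-! ### Elementary real inequalities -/

section Real

/-- Young: `2 a b ≤ (ν/4) a² + (4/ν) b²` (`ν > 0`). [folklore] -/
theorem two_mul_le_young {ν : ℝ} (hν : 0 < ν) (a b : ℝ) :
    2 * a * b ≤ ν / 4 * a ^ 2 + 4 / ν * b ^ 2 := by
  have key : ν / 4 * a ^ 2 + 4 / ν * b ^ 2 - 2 * a * b = (ν * a / 2 - 2 * b) ^ 2 / ν := by
    field_simp
    ring
  have : 0 ≤ (ν * a / 2 - 2 * b) ^ 2 / ν := div_nonneg (sq_nonneg _) hν.le
  linarith

/-- Young: `a b ≤ (ν/4) a² + b²/ν` (`ν > 0`). [folklore] -/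
theorem mul_le_young {ν : ℝ} (hν : 0 < ν) (a b : ℝ) : a * b ≤ ν / 4 * a ^ 2 + b ^ 2 / ν := by
  have key : ν / 4 * a ^ 2 + b ^ 2 / ν - a * b = (ν * a / 2 - b) ^ 2 / ν := by
    field_simp
    ring
  have : 0 ≤ (ν * a / 2 - b) ^ 2 / ν := div_nonneg (sq_nonneg _) hν.le
  linarith

/-- Young: `4ν a b ≤ (ν/4) a² + 16 ν b²` (`ν ≥ 0`). [folklore] -/
theorem four_mul_le_young {ν : ℝ} (hν : 0 ≤ ν) (a b : ℝ) :
    4 * ν * a * b ≤ ν / 4 * a ^ 2 + 16 * ν * b ^ 2 := by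
  nlinarith [mul_nonneg hν (sq_nonneg (a / 2 - 4 * b))]

end Real

/-! ### The term estimates -/

section Terms

variable {E : Type*} [NormedAddCommGroup E] [InnerProductSpace ℝ E] [FiniteDimensional ℝ E]
  [MeasurableSpace E] [BorelSpace E]

omit [MeasurableSpace E] [BorelSpace E] in
/-- The operator norm is dominated by the Frobenius norm: `‖L‖ ≤ √|L|²`. [folklore] -/
theorem opNorm_le_sqrt_frobeniusNormSq {F' : Type*} [NormedAddCommGroup F'] [InnerProductSpace ℝ F']
    (L : E →L[ℝ] F') : ‖L‖ ≤ Real.sqrt (frobeniusNormSq L) :=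
  Real.le_sqrt_of_sq_le (sq_opNorm_le_frobeniusNormSq L)

omit [MeasurableSpace E] [BorelSpace E] in
/-- `‖∇(χ_R²)(x)‖ ≤ 2 C₁/R`. [folklore] -/
theorem norm_gradient_cutoff_sq_le {R C₁ : ℝ} (hC₁ : ∀ x : E, ‖fderiv ℝ (cutoff R) x‖ ≤ C₁ / R)
    (x : E) : ‖gradient (fun y : E => cutoff R y ^ 2) x‖ ≤ 2 * (C₁ / R) := by
  rw [norm_gradient_eq_norm_fderiv, fderiv_cutoff_sq, norm_smul, Real.norm_eq_abs, abs_mul,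
    abs_of_nonneg (cutoff_nonneg R x), abs_two]
  have h1 : cutoff R x ≤ 1 := cutoff_le_one R x
  have h2 : 0 ≤ cutoff R x := cutoff_nonneg R x
  have h3 : ‖fderiv ℝ (cutoff R) x‖ ≤ C₁ / R := hC₁ x
  have h4 : 0 ≤ ‖fderiv ℝ (cutoff R) x‖ := norm_nonneg _
  nlinarith [mul_le_mul h1 h3 h4 zero_le_one]

/-- **The transport (cutoff) term**: `|∫ |v|²⟪w, ∇φ_R⟫| ≤ (2C₁/R) ‖v‖₃² ‖w‖₃`
(GIP 2003, proof of Thm. 2.1: the transport of `|v|²` by `u`, here seen only through the cutoff).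
[cite: GallagherIftimiePlanchon2003, Thm. 2.1 (proof, (8))] -/
theorem abs_transport_term_le {v w : E → E} (hv : MemLp v 3 volume) (hw : MemLp w 3 volume)
    {R C₁ : ℝ} (hC₁ : ∀ x : E, ‖fderiv ℝ (cutoff R) x‖ ≤ C₁ / R) :
    |∫ x, ‖v x‖ ^ 2 * ⟪w x, gradient (fun y : E => cutoff R y ^ 2) x⟫| ≤
      2 * (C₁ / R) * (eLpNorm v 3 volume * eLpNorm v 3 volume * eLpNorm w 3 volume).toReal := by
  have hk : 0 ≤ 2 * (C₁ / R) := by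
    have := le_trans (norm_nonneg _) (hC₁ 0); positivity
  refine abs_integral_le_of_le_mul_three hk (fun x => ?_) hv hv hw
  rw [abs_mul, abs_of_nonneg (sq_nonneg _)]
  calc ‖v x‖ ^ 2 * |⟪w x, gradient (fun y : E => cutoff R y ^ 2) x⟫|
      ≤ ‖v x‖ ^ 2 * (‖w x‖ * ‖gradient (fun y : E => cutoff R y ^ 2) x‖) := by
        gcongr; exact abs_real_inner_le_norm _ _
    _ ≤ ‖v x‖ ^ 2 * (‖w x‖ * (2 * (C₁ / R))) := by
        gcongr; exact norm_gradient_cutoff_sq_le hC₁ x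
    _ = 2 * (C₁ / R) * (‖v x‖ * ‖v x‖ * ‖w x‖) := by ring

/-- **The coupling cutoff terms**: `|2∫⟪v,e⟫⟪v,∇φ_R⟫| ≤ (4C₁/R)‖v‖₃²‖e‖₃` and
`|2∫⟪v,e⟫⟪e,∇φ_R⟫| ≤ (4C₁/R)‖v‖₃‖e‖₃²` (Lemarié-Rieusset 2016, proof of Thm. 14.7, p. 516, the
transport of `|u₁|²` and of `w·u₁`, here seen only through the cutoff).
[cite: LemarieRieusset2016, Thm. 14.7 (proof, p. 516)] -/
theorem abs_coupling_cutoff_terms_le {v e : E → E} (hv : MemLp v 3 volume) (he : MemLp e 3 volume)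
    {R C₁ : ℝ} (hC₁ : ∀ x : E, ‖fderiv ℝ (cutoff R) x‖ ≤ C₁ / R) :
    |2 * ∫ x, ⟪v x, e x⟫ * ⟪v x, gradient (fun y : E => cutoff R y ^ 2) x⟫| ≤
        4 * (C₁ / R) * (eLpNorm v 3 volume * eLpNorm e 3 volume * eLpNorm v 3 volume).toReal ∧
      |2 * ∫ x, ⟪v x, e x⟫ * ⟪e x, gradient (fun y : E => cutoff R y ^ 2) x⟫| ≤
        4 * (C₁ / R) * (eLpNorm v 3 volume * eLpNorm e 3 volume * eLpNorm e 3 volume).toReal := by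
  have hk : 0 ≤ 2 * (C₁ / R) := by
    have := le_trans (norm_nonneg _) (hC₁ 0); positivity
  have hpt : ∀ (a : E → E) (x : E), |⟪v x, e x⟫ * ⟪a x, gradient (fun y : E => cutoff R y ^ 2) x⟫| ≤
      2 * (C₁ / R) * (‖v x‖ * ‖e x‖ * ‖a x‖) := by
    intro a x
    rw [abs_mul]
    calc |⟪v x, e x⟫| * |⟪a x, gradient (fun y : E => cutoff R y ^ 2) x⟫|
        ≤ (‖v x‖ * ‖e x‖) * (‖a x‖ * ‖gradient (fun y : E => cutoff R y ^ 2) x‖) :=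
          mul_le_mul (abs_real_inner_le_norm _ _) (abs_real_inner_le_norm _ _) (abs_nonneg _)
            (by positivity)
      _ ≤ (‖v x‖ * ‖e x‖) * (‖a x‖ * (2 * (C₁ / R))) := by
          gcongr; exact norm_gradient_cutoff_sq_le hC₁ x
      _ = 2 * (C₁ / R) * (‖v x‖ * ‖e x‖ * ‖a x‖) := by ring
  constructor
  · have h := abs_integral_le_of_le_mul_three hk (hpt v) hv he hv
    rw [abs_mul, abs_two]
    linarith
  · have h := abs_integral_le_of_le_mul_three hk (hpt e) hv he he
    rw [abs_mul, abs_two]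
    linarith

/-! #### The localised gradient weight `∫ ‖Dχ_R‖² |v|²` -/

/-- **The cutoff-gradient weight is small**: for `v ∈ L³` and `R ≥ 1`,
`∫ (‖Dχ_R‖ |v|)² ≤ (2 C₁² V / R) ‖v‖₃²` with `V = |B̄(0,1)|^{1/3}` (support of `Dχ_R` in
`B̄(0, 2R)`, `‖Dχ_R‖ ≤ C₁/R`, Hölder on the ball `∫_{B̄(0,2R)} |v|² ≤ |B̄(0,2R)|^{1/3}‖v‖₃²` and
`|B̄(0,2R)|^{1/3} = 2R |B̄(0,1)|^{1/3}`). [folklore] -/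
theorem integral_sq_norm_fderiv_cutoff_mul_norm_le (hE : Module.finrank ℝ E = 3) {v : E → E}
    (hv : MemLp v 3 volume) {R C₁ : ℝ} (hR : 1 ≤ R)
    (hC₁ : ∀ x : E, ‖fderiv ℝ (cutoff R) x‖ ≤ C₁ / R) :
    ∫ x, (‖fderiv ℝ (cutoff R) x‖ * ‖v x‖) ^ 2 ≤
      2 * C₁ ^ 2 * ((volume (closedBall (0 : E) 1)) ^ (1 / 3 : ℝ)).toReal / R *
        (eLpNorm v 3 volume ^ 2).toReal := by
  have hR0 : 0 < R := one_pos.trans_le hR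
  have hBm : MeasurableSet (closedBall (0 : E) (2 * R)) := measurableSet_closedBall
  have hBfin : volume (closedBall (0 : E) (2 * R)) ≠ ⊤ := (isCompact_closedBall _ _).measure_ne_top
  -- the pointwise bound
  have hpt : ∀ x, (‖fderiv ℝ (cutoff R) x‖ * ‖v x‖) ^ 2 ≤
      (C₁ / R) ^ 2 * (closedBall (0 : E) (2 * R)).indicator (fun x => ‖v x‖ ^ 2) x := by
    intro x
    have h := norm_fderiv_cutoff_le_indicator hR0 hC₁ x
    by_cases hx : x ∈ closedBall (0 : E) (2 * R)
    · rw [indicator_of_mem hx]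
      rw [indicator_of_mem hx, mul_one] at h
      calc (‖fderiv ℝ (cutoff R) x‖ * ‖v x‖) ^ 2 = ‖fderiv ℝ (cutoff R) x‖ ^ 2 * ‖v x‖ ^ 2 := by ring
        _ ≤ (C₁ / R) ^ 2 * ‖v x‖ ^ 2 := by
            gcongr
    · rw [indicator_of_notMem hx, mul_zero]
      rw [indicator_of_notMem hx, mul_zero] at h
      have h0 : ‖fderiv ℝ (cutoff R) x‖ = 0 := le_antisymm h (norm_nonneg _)
      rw [h0, zero_mul, zero_pow two_ne_zero]
  -- integrability of the majorant
  have hvB : MemLp v 3 (volume.restrict (closedBall (0 : E) (2 * R))) := hv.restrict _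
  haveI : IsFiniteMeasure (volume.restrict (closedBall (0 : E) (2 * R))) :=
    ⟨by rw [Measure.restrict_apply_univ]; exact hBfin.lt_top⟩
  have hv2B : MemLp v 2 (volume.restrict (closedBall (0 : E) (2 * R))) := hvB.mono_exponent (by norm_num)
  have hIB : IntegrableOn (fun x => ‖v x‖ ^ 2) (closedBall (0 : E) (2 * R)) volume :=
    (memLp_two_iff_integrable_sq_norm hvB.1).1 hv2B
  have hI : Integrable ((closedBall (0 : E) (2 * R)).indicator fun x => ‖v x‖ ^ 2) volume :=
    hIB.integrable_indicator hBm
  -- the volume factor `|B̄(0,2R)|^{1/3} = 2R |B̄(0,1)|^{1/3}`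
  have hvol : ((volume (closedBall (0 : E) (2 * R))) ^ (1 / 3 : ℝ)).toReal =
      2 * R * ((volume (closedBall (0 : E) 1)) ^ (1 / 3 : ℝ)).toReal := by
    rw [Measure.addHaar_closedBall' volume (0 : E) (by positivity : (0 : ℝ) ≤ 2 * R), hE,
      ENNReal.mul_rpow_of_nonneg _ _ (by norm_num : (0 : ℝ) ≤ 1 / 3), ENNReal.toReal_mul]
    congr 1
    rw [← ENNReal.toReal_rpow, ENNReal.toReal_ofReal (by positivity), ← Real.rpow_natCast,
      ← Real.rpow_mul (by positivity)]
    norm_num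
  calc ∫ x, (‖fderiv ℝ (cutoff R) x‖ * ‖v x‖) ^ 2
      ≤ ∫ x, (C₁ / R) ^ 2 * (closedBall (0 : E) (2 * R)).indicator (fun x => ‖v x‖ ^ 2) x :=
        integral_mono_of_nonneg (Eventually.of_forall fun x => by positivity) (hI.const_mul _)
          (Eventually.of_forall hpt)
    _ = (C₁ / R) ^ 2 * ∫ x in closedBall (0 : E) (2 * R), ‖v x‖ ^ 2 := by
        rw [integral_const_mul, integral_indicator hBm]
    _ ≤ (C₁ / R) ^ 2 * ((volume (closedBall (0 : E) (2 * R))) ^ (1 / 3 : ℝ) *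
          eLpNorm v 3 volume ^ 2).toReal := by
        gcongr; exact setIntegral_norm_sq_le hv hBfin
    _ = 2 * C₁ ^ 2 * ((volume (closedBall (0 : E) 1)) ^ (1 / 3 : ℝ)).toReal / R *
          (eLpNorm v 3 volume ^ 2).toReal := by
        rw [ENNReal.toReal_mul, hvol]
        field_simp

/-! #### The localised dissipation density `f = χ √|Dv|²` -/

/-- The localised dissipation density `f = χ_R √|Dv|²_F` is continuous, compactly supported, and
`∫ f² = X := ∫ χ_R² |Dv|²_F`. [folklore] -/
theorem dissipationDensity_props {v : E → E} (hv1 : ContDiff ℝ 1 v) {R : ℝ} (hR : 0 < R) :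
    Continuous (fun x => cutoff R x * Real.sqrt (frobeniusNormSq (fderiv ℝ v x))) ∧
      HasCompactSupport (fun x => cutoff R x * Real.sqrt (frobeniusNormSq (fderiv ℝ v x))) ∧
      MemLp (fun x => cutoff R x * Real.sqrt (frobeniusNormSq (fderiv ℝ v x))) 2 volume ∧
      ∫ x, (cutoff R x * Real.sqrt (frobeniusNormSq (fderiv ℝ v x))) ^ 2 =
        ∫ x, cutoff R x ^ 2 * frobeniusNormSq (fderiv ℝ v x) := by
  have hc : Continuous fun x => cutoff R x * Real.sqrt (frobeniusNormSq (fderiv ℝ v x)) :=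
    (contDiff_cutoff (n := 1) R).continuous.mul
      (Real.continuous_sqrt.comp (continuous_frobeniusNormSq_fderiv hv1 one_ne_zero))
  have hs : HasCompactSupport fun x => cutoff R x * Real.sqrt (frobeniusNormSq (fderiv ℝ v x)) :=
    (hasCompactSupport_cutoff hR).mul_right
  refine ⟨hc, hs, hc.memLp_of_hasCompactSupport hs, integral_congr_ae (Eventually.of_forall fun x => ?_)⟩
  simp only [mul_pow, Real.sq_sqrt (frobeniusNormSq_nonneg _)]

omit [MeasurableSpace E] [BorelSpace E] in
/-- Pointwise: `|⟪Dv(a), b⟫| ≤ √|Dv|²_F ‖a‖ ‖b‖`. [folklore] -/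
theorem abs_inner_fderiv_apply_le {v : E → E} (x : E) (a b : E) :
    |⟪fderiv ℝ v x a, b⟫| ≤ Real.sqrt (frobeniusNormSq (fderiv ℝ v x)) * ‖a‖ * ‖b‖ := by
  calc |⟪fderiv ℝ v x a, b⟫| ≤ ‖fderiv ℝ v x a‖ * ‖b‖ := abs_real_inner_le_norm _ _
    _ ≤ (‖fderiv ℝ v x‖ * ‖a‖) * ‖b‖ := by
        gcongr; exact ContinuousLinearMap.le_opNorm _ _
    _ ≤ (Real.sqrt (frobeniusNormSq (fderiv ℝ v x)) * ‖a‖) * ‖b‖ := by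
        gcongr; exact opNorm_le_sqrt_frobeniusNormSq _

/-- **The gradient cutoff term is absorbed up to an error**:
`2ν |∫ ⟪Dv(∇φ_R), v⟫| ≤ (ν/4) X + 16ν · (2C₁²V/R) ‖v‖₃²` (Cauchy–Schwarz between `χ√|Dv|²` and
`‖Dχ‖ |v|`, the weight bound `integral_sq_norm_fderiv_cutoff_mul_norm_le`, Young).
[cite: GallagherIftimiePlanchon2003, Thm. 2.1 (proof, (8))] -/
theorem abs_gradient_cutoff_term_le (hE : Module.finrank ℝ E = 3) {v : E → E}
    (hv1 : ContDiff ℝ 1 v) (hv3 : MemLp v 3 volume) {R C₁ ν : ℝ} (hR : 1 ≤ R)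
    (hC₁ : ∀ x : E, ‖fderiv ℝ (cutoff R) x‖ ≤ C₁ / R) (hν : 0 ≤ ν) :
    2 * ν * |∫ x, ⟪fderiv ℝ v x (gradient (fun y : E => cutoff R y ^ 2) x), v x⟫| ≤
      ν / 4 * (∫ x, cutoff R x ^ 2 * frobeniusNormSq (fderiv ℝ v x)) +
        16 * ν * (2 * C₁ ^ 2 * ((volume (closedBall (0 : E) 1)) ^ (1 / 3 : ℝ)).toReal / R *
          (eLpNorm v 3 volume ^ 2).toReal) := by
  have hR0 : 0 < R := one_pos.trans_le hR
  obtain ⟨hfc, hfs, hf2, hfX⟩ := dissipationDensity_props hv1 hR0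
  set X : ℝ := ∫ x, cutoff R x ^ 2 * frobeniusNormSq (fderiv ℝ v x) with hX
  set bd : ℝ := 2 * C₁ ^ 2 * ((volume (closedBall (0 : E) 1)) ^ (1 / 3 : ℝ)).toReal / R *
    (eLpNorm v 3 volume ^ 2).toReal with hbd
  -- the weight `g = ‖Dχ‖ |v|`
  have hgc : Continuous fun x => ‖fderiv ℝ (cutoff R) x‖ * ‖v x‖ :=
    ((contDiff_cutoff (n := 1) R).continuous_fderiv one_ne_zero).norm.mul hv1.continuous.norm
  have hDχs : HasCompactSupport (fderiv ℝ (cutoff (E := E) R)) :=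
    (hasCompactSupport_cutoff hR0).fderiv ℝ
  have hgs : HasCompactSupport fun x => ‖fderiv ℝ (cutoff R) x‖ * ‖v x‖ := hDχs.norm.mul_right
  have hg2 : MemLp (fun x => ‖fderiv ℝ (cutoff R) x‖ * ‖v x‖) 2 volume := hgc.memLp_of_hasCompactSupport hgs
  have hgbd : ∫ x, (‖fderiv ℝ (cutoff R) x‖ * ‖v x‖) ^ 2 ≤ bd :=
    integral_sq_norm_fderiv_cutoff_mul_norm_le hE hv3 hR hC₁
  -- pointwise: `|⟪Dv(∇φ), v⟫| ≤ 2 f g`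
  have hpt : ∀ x, |⟪fderiv ℝ v x (gradient (fun y : E => cutoff R y ^ 2) x), v x⟫| ≤
      2 * ((cutoff R x * Real.sqrt (frobeniusNormSq (fderiv ℝ v x))) *
        (‖fderiv ℝ (cutoff R) x‖ * ‖v x‖)) := by
    intro x
    have hgrad : fderiv ℝ v x (gradient (fun y : E => cutoff R y ^ 2) x) =
        (2 * cutoff R x) • fderiv ℝ v x (gradient (cutoff R) x) := by
      rw [gradient_cutoff_sq, ContinuousLinearMap.map_smul]
    rw [hgrad, real_inner_smul_left, abs_mul,
      abs_of_nonneg (by linarith [cutoff_nonneg R x] : (0 : ℝ) ≤ 2 * cutoff R x)]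
    have h := abs_inner_fderiv_apply_le (v := v) x (gradient (cutoff R) x) (v x)
    rw [norm_gradient_eq_norm_fderiv] at h
    have hχ : 0 ≤ cutoff R x := cutoff_nonneg R x
    calc 2 * cutoff R x * |⟪fderiv ℝ v x (gradient (cutoff R) x), v x⟫|
        ≤ 2 * cutoff R x * (Real.sqrt (frobeniusNormSq (fderiv ℝ v x)) *
            ‖fderiv ℝ (cutoff R) x‖ * ‖v x‖) := by gcongr
      _ = 2 * ((cutoff R x * Real.sqrt (frobeniusNormSq (fderiv ℝ v x))) *
            (‖fderiv ℝ (cutoff R) x‖ * ‖v x‖)) := by ring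
  -- Cauchy–Schwarz
  have hI : Integrable (fun x => 2 * ((cutoff R x * Real.sqrt (frobeniusNormSq (fderiv ℝ v x))) *
      (‖fderiv ℝ (cutoff R) x‖ * ‖v x‖))) volume :=
    ((hfc.mul hgc).integrable_of_hasCompactSupport hfs.mul_right).const_mul 2
  have hCS := integral_mul_le_sqrt_mul_sqrt_of_memLp hf2 hg2
  rw [hfX] at hCS
  have hT : |∫ x, ⟪fderiv ℝ v x (gradient (fun y : E => cutoff R y ^ 2) x), v x⟫| ≤
      2 * (Real.sqrt X * Real.sqrt bd) := by
    calc |∫ x, ⟪fderiv ℝ v x (gradient (fun y : E => cutoff R y ^ 2) x), v x⟫|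
        ≤ ∫ x, |⟪fderiv ℝ v x (gradient (fun y : E => cutoff R y ^ 2) x), v x⟫| :=
          abs_integral_le_integral_abs
      _ ≤ ∫ x, 2 * ((cutoff R x * Real.sqrt (frobeniusNormSq (fderiv ℝ v x))) *
            (‖fderiv ℝ (cutoff R) x‖ * ‖v x‖)) :=
          integral_mono_of_nonneg (Eventually.of_forall fun x => abs_nonneg _) hI
            (Eventually.of_forall hpt)
      _ = 2 * ∫ x, (cutoff R x * Real.sqrt (frobeniusNormSq (fderiv ℝ v x))) *
            (‖fderiv ℝ (cutoff R) x‖ * ‖v x‖) := integral_const_mul _ _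
      _ ≤ 2 * (Real.sqrt X * Real.sqrt (∫ x, (‖fderiv ℝ (cutoff R) x‖ * ‖v x‖) ^ 2)) := by
          gcongr
      _ ≤ 2 * (Real.sqrt X * Real.sqrt bd) := by gcongr
  -- Young
  have hX0 : 0 ≤ X := by
    rw [hX]; exact integral_nonneg fun x => mul_nonneg (sq_nonneg _) (frobeniusNormSq_nonneg _)
  have hbd0 : 0 ≤ bd := le_trans (integral_nonneg fun x => sq_nonneg _) hgbd
  have hY := four_mul_le_young hν (Real.sqrt X) (Real.sqrt bd)
  rw [Real.sq_sqrt hX0, Real.sq_sqrt hbd0] at hY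
  calc 2 * ν * |∫ x, ⟪fderiv ℝ v x (gradient (fun y : E => cutoff R y ^ 2) x), v x⟫|
      ≤ 2 * ν * (2 * (Real.sqrt X * Real.sqrt bd)) := by gcongr
    _ = 4 * ν * Real.sqrt X * Real.sqrt bd := by ring
    _ ≤ ν / 4 * X + 16 * ν * bd := hY

/-- **The source term**: `2|∫ φ_R ⟪Dv(e), e⟫| ≤ (ν/4) X + (4/ν) ∫ |e|⁴`
(Lemarié-Rieusset 2016, proof of Thm. 14.7, p. 516: "`2|⟪∇w(e), e⟫| ≤ ν|∇w|² + ν⁻¹|e|⁴`").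
[cite: LemarieRieusset2016, Thm. 14.7 (proof, p. 516)] -/
theorem abs_source_term_le {v e : E → E} (hv1 : ContDiff ℝ 1 v) (he0 : Continuous e)
    (he4 : MemLp e 4 volume) {R ν : ℝ} (hR : 0 < R) (hν : 0 < ν) :
    2 * |∫ x, cutoff R x ^ 2 * ⟪fderiv ℝ v x (e x), e x⟫| ≤
      ν / 4 * (∫ x, cutoff R x ^ 2 * frobeniusNormSq (fderiv ℝ v x)) + 4 / ν * ∫ x, ‖e x‖ ^ 4 := by
  obtain ⟨hfc, hfs, hf2, hfX⟩ := dissipationDensity_props hv1 hR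
  set X : ℝ := ∫ x, cutoff R x ^ 2 * frobeniusNormSq (fderiv ℝ v x) with hX
  -- the weight `g = χ |e|²`
  have hgc : Continuous fun x => cutoff R x * ‖e x‖ ^ 2 :=
    (contDiff_cutoff (n := 1) R).continuous.mul (he0.norm.pow 2)
  have hgs : HasCompactSupport fun x => cutoff R x * ‖e x‖ ^ 2 := (hasCompactSupport_cutoff hR).mul_right
  have hg2 : MemLp (fun x => cutoff R x * ‖e x‖ ^ 2) 2 volume := hgc.memLp_of_hasCompactSupport hgs
  have he4i : Integrable (fun x => ‖e x‖ ^ 4) volume := he4.integrable_norm_pow (by norm_num)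
  have hgbd : ∫ x, (cutoff R x * ‖e x‖ ^ 2) ^ 2 ≤ ∫ x, ‖e x‖ ^ 4 := by
    refine integral_mono_of_nonneg (Eventually.of_forall fun x => sq_nonneg _) he4i
      (Eventually.of_forall fun x => ?_)
    have h1 := cutoff_sq_le_one R x
    show (cutoff R x * ‖e x‖ ^ 2) ^ 2 ≤ ‖e x‖ ^ 4
    have : (cutoff R x * ‖e x‖ ^ 2) ^ 2 = cutoff R x ^ 2 * ‖e x‖ ^ 4 := by ring
    rw [this]
    have h4 : 0 ≤ ‖e x‖ ^ 4 := by positivity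
    calc cutoff R x ^ 2 * ‖e x‖ ^ 4 ≤ 1 * ‖e x‖ ^ 4 := mul_le_mul_of_nonneg_right h1 h4
      _ = ‖e x‖ ^ 4 := one_mul _
  -- pointwise: `|χ² ⟪Dv(e), e⟫| ≤ f g`
  have hpt : ∀ x, |cutoff R x ^ 2 * ⟪fderiv ℝ v x (e x), e x⟫| ≤
      (cutoff R x * Real.sqrt (frobeniusNormSq (fderiv ℝ v x))) * (cutoff R x * ‖e x‖ ^ 2) := by
    intro x
    rw [abs_mul, abs_of_nonneg (sq_nonneg _)]
    have h := abs_inner_fderiv_apply_le (v := v) x (e x) (e x)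
    have hχ : 0 ≤ cutoff R x ^ 2 := sq_nonneg _
    calc cutoff R x ^ 2 * |⟪fderiv ℝ v x (e x), e x⟫|
        ≤ cutoff R x ^ 2 * (Real.sqrt (frobeniusNormSq (fderiv ℝ v x)) * ‖e x‖ * ‖e x‖) :=
          mul_le_mul_of_nonneg_left h hχ
      _ = (cutoff R x * Real.sqrt (frobeniusNormSq (fderiv ℝ v x))) * (cutoff R x * ‖e x‖ ^ 2) := by
          ring
  have hI : Integrable (fun x => (cutoff R x * Real.sqrt (frobeniusNormSq (fderiv ℝ v x))) *
      (cutoff R x * ‖e x‖ ^ 2)) volume :=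
    (hfc.mul hgc).integrable_of_hasCompactSupport hfs.mul_right
  have hCS := integral_mul_le_sqrt_mul_sqrt_of_memLp hf2 hg2
  rw [hfX] at hCS
  have hT : |∫ x, cutoff R x ^ 2 * ⟪fderiv ℝ v x (e x), e x⟫| ≤
      Real.sqrt X * Real.sqrt (∫ x, ‖e x‖ ^ 4) := by
    calc |∫ x, cutoff R x ^ 2 * ⟪fderiv ℝ v x (e x), e x⟫|
        ≤ ∫ x, |cutoff R x ^ 2 * ⟪fderiv ℝ v x (e x), e x⟫| := abs_integral_le_integral_abs
      _ ≤ ∫ x, (cutoff R x * Real.sqrt (frobeniusNormSq (fderiv ℝ v x))) * (cutoff R x * ‖e x‖ ^ 2) :=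
          integral_mono_of_nonneg (Eventually.of_forall fun x => abs_nonneg _) hI
            (Eventually.of_forall hpt)
      _ ≤ Real.sqrt X * Real.sqrt (∫ x, (cutoff R x * ‖e x‖ ^ 2) ^ 2) := hCS
      _ ≤ Real.sqrt X * Real.sqrt (∫ x, ‖e x‖ ^ 4) := by gcongr
  -- Young
  have hX0 : 0 ≤ X := by
    rw [hX]; exact integral_nonneg fun x => mul_nonneg (sq_nonneg _) (frobeniusNormSq_nonneg _)
  have hE40 : 0 ≤ ∫ x, ‖e x‖ ^ 4 := integral_nonneg fun x => by positivity
  have hY := two_mul_le_young hν (Real.sqrt X) (Real.sqrt (∫ x, ‖e x‖ ^ 4))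
  rw [Real.sq_sqrt hX0, Real.sq_sqrt hE40] at hY
  calc 2 * |∫ x, cutoff R x ^ 2 * ⟪fderiv ℝ v x (e x), e x⟫|
      ≤ 2 * (Real.sqrt X * Real.sqrt (∫ x, ‖e x‖ ^ 4)) := by gcongr
    _ = 2 * Real.sqrt X * Real.sqrt (∫ x, ‖e x‖ ^ 4) := by ring
    _ ≤ ν / 4 * X + 4 / ν * ∫ x, ‖e x‖ ^ 4 := hY

/-! #### The absorbed term: Gagliardo–Nirenberg–Sobolev on `χ v` -/

/-- **The derivative of the truncated field**: `∫ ‖D(χ_R v)‖² ≤ 2X + 2∫(‖Dχ_R‖|v|)²`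
(`D(χv) = χ Dv + Dχ ⊗ v`, `‖Dv‖ ≤ √|Dv|²_F`). [folklore] -/
theorem integral_norm_fderiv_cutoff_smul_sq_le {v : E → E} (hv1 : ContDiff ℝ 1 v) {R : ℝ}
    (hR : 0 < R) :
    ∫ x, ‖fderiv ℝ (fun y => cutoff R y • v y) x‖ ^ 2 ≤
      2 * (∫ x, cutoff R x ^ 2 * frobeniusNormSq (fderiv ℝ v x)) +
        2 * ∫ x, (‖fderiv ℝ (cutoff R) x‖ * ‖v x‖) ^ 2 := by
  obtain ⟨hfc, hfs, hf2, hfX⟩ := dissipationDensity_props hv1 hR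
  have hχd : ∀ x : E, DifferentiableAt ℝ (cutoff R) x := fun x =>
    (contDiff_cutoff (n := 1) R).differentiable one_ne_zero x
  have hvd : ∀ x : E, DifferentiableAt ℝ v x := fun x => hv1.differentiable one_ne_zero x
  -- pointwise
  have hpt : ∀ x, ‖fderiv ℝ (fun y => cutoff R y • v y) x‖ ^ 2 ≤
      2 * (cutoff R x * Real.sqrt (frobeniusNormSq (fderiv ℝ v x))) ^ 2 +
        2 * (‖fderiv ℝ (cutoff R) x‖ * ‖v x‖) ^ 2 := by
    intro x
    have h1 : ‖fderiv ℝ (fun y => cutoff R y • v y) x‖ ≤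
        cutoff R x * Real.sqrt (frobeniusNormSq (fderiv ℝ v x)) + ‖fderiv ℝ (cutoff R) x‖ * ‖v x‖ := by
      rw [fderiv_fun_smul (hχd x) (hvd x)]
      calc ‖cutoff R x • fderiv ℝ v x + (fderiv ℝ (cutoff R) x).smulRight (v x)‖
          ≤ ‖cutoff R x • fderiv ℝ v x‖ + ‖(fderiv ℝ (cutoff R) x).smulRight (v x)‖ := norm_add_le _ _
        _ = cutoff R x * ‖fderiv ℝ v x‖ + ‖fderiv ℝ (cutoff R) x‖ * ‖v x‖ := by
            rw [norm_smul, Real.norm_of_nonneg (cutoff_nonneg R x),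
              ContinuousLinearMap.norm_smulRight_apply]
        _ ≤ cutoff R x * Real.sqrt (frobeniusNormSq (fderiv ℝ v x)) + ‖fderiv ℝ (cutoff R) x‖ * ‖v x‖ := by
            gcongr
            · exact cutoff_nonneg R x
            · exact opNorm_le_sqrt_frobeniusNormSq _
    have h0 : 0 ≤ ‖fderiv ℝ (fun y => cutoff R y • v y) x‖ := norm_nonneg _
    nlinarith [h1, h0, sq_nonneg (cutoff R x * Real.sqrt (frobeniusNormSq (fderiv ℝ v x)) -
      ‖fderiv ℝ (cutoff R) x‖ * ‖v x‖)]
  -- integrability of the majorant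
  have hgc : Continuous fun x => ‖fderiv ℝ (cutoff R) x‖ * ‖v x‖ :=
    ((contDiff_cutoff (n := 1) R).continuous_fderiv one_ne_zero).norm.mul hv1.continuous.norm
  have hDχs : HasCompactSupport (fderiv ℝ (cutoff (E := E) R)) := (hasCompactSupport_cutoff hR).fderiv ℝ
  have hgs : HasCompactSupport fun x => ‖fderiv ℝ (cutoff R) x‖ * ‖v x‖ := hDχs.norm.mul_right
  have hg2 : MemLp (fun x => ‖fderiv ℝ (cutoff R) x‖ * ‖v x‖) 2 volume := hgc.memLp_of_hasCompactSupport hgs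
  have hIf : Integrable (fun x => (cutoff R x * Real.sqrt (frobeniusNormSq (fderiv ℝ v x))) ^ 2) volume :=
    hf2.integrable_sq
  have hIg : Integrable (fun x => (‖fderiv ℝ (cutoff R) x‖ * ‖v x‖) ^ 2) volume := hg2.integrable_sq
  calc ∫ x, ‖fderiv ℝ (fun y => cutoff R y • v y) x‖ ^ 2
      ≤ ∫ x, (2 * (cutoff R x * Real.sqrt (frobeniusNormSq (fderiv ℝ v x))) ^ 2 +
          2 * (‖fderiv ℝ (cutoff R) x‖ * ‖v x‖) ^ 2) :=
        integral_mono_of_nonneg (Eventually.of_forall fun x => sq_nonneg _)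
          ((hIf.const_mul 2).add (hIg.const_mul 2)) (Eventually.of_forall hpt)
    _ = 2 * (∫ x, cutoff R x ^ 2 * frobeniusNormSq (fderiv ℝ v x)) +
          2 * ∫ x, (‖fderiv ℝ (cutoff R) x‖ * ‖v x‖) ^ 2 := by
        rw [integral_add (hIf.const_mul 2) (hIg.const_mul 2), integral_const_mul, integral_const_mul, hfX]

/-- **The `L⁶` norm of the truncated field** (Gagliardo–Nirenberg–Sobolev in dimension three,
`rpow_integral_norm_pow_six_le`): `(∫ ‖χ_R v‖⁶)^{1/6} ≤ K √(2X + 2∫(‖Dχ_R‖|v|)²)`.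
[folklore] -/
theorem rpow_integral_norm_cutoff_smul_pow_six_le (hE : Module.finrank ℝ E = 3) {v : E → E}
    (hv1 : ContDiff ℝ 1 v) {R : ℝ} (hR : 0 < R) :
    (∫ x, ‖cutoff R x • v x‖ ^ 6) ^ (6 : ℝ)⁻¹ ≤
      (eLpNormLESNormFDerivOfEqInnerConst (volume : Measure E) 2 : ℝ) *
        Real.sqrt (2 * (∫ x, cutoff R x ^ 2 * frobeniusNormSq (fderiv ℝ v x)) +
          2 * ∫ x, (‖fderiv ℝ (cutoff R) x‖ * ‖v x‖) ^ 2) := by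
  have hχv1 : ContDiff ℝ 1 fun y => cutoff R y • v y := (contDiff_cutoff (n := 1) R).smul hv1
  have hχvs : HasCompactSupport fun y => cutoff R y • v y := (hasCompactSupport_cutoff hR).smul_right
  have h := rpow_integral_norm_pow_six_le (volume : Measure E) hE hχv1 hχvs
  refine h.trans (mul_le_mul_of_nonneg_left ?_ (NNReal.coe_nonneg _))
  rw [show ((2 : ℝ)⁻¹) = 1 / 2 by norm_num, ← Real.sqrt_eq_rpow]
  exact Real.sqrt_le_sqrt (integral_norm_fderiv_cutoff_smul_sq_le hv1 hR)

/-- **Hölder for the absorbed weight**: `∫ ‖χ_R v‖² |e|² ≤ ((∫‖χ_R v‖⁶)^{1/6})² ‖e‖₃²`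
(exponents `3` and `3/2`). [folklore] -/
theorem integral_norm_cutoff_smul_sq_mul_norm_sq_le {v e : E → E} (hv0 : Continuous v)
    (he3 : MemLp e 3 volume) {R : ℝ} (hR : 0 < R) :
    ∫ x, ‖cutoff R x • v x‖ ^ 2 * ‖e x‖ ^ 2 ≤
      ((∫ x, ‖cutoff R x • v x‖ ^ 6) ^ (6 : ℝ)⁻¹) ^ 2 * (eLpNorm e 3 volume).toReal ^ 2 := by
  have hpq : Real.HolderConjugate (3 : ℝ) (3 / 2) := ⟨by norm_num, by norm_num, by norm_num⟩
  -- the two factors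
  have hχvc : Continuous fun x => cutoff R x • v x := (contDiff_cutoff (n := 1) R).continuous.smul hv0
  have hχs : HasCompactSupport (cutoff (E := E) R) := hasCompactSupport_cutoff hR
  have hχvs : HasCompactSupport fun x => cutoff R x • v x := hχs.smul_right
  have hf2c : Continuous fun x => ‖cutoff R x • v x‖ ^ 2 := hχvc.norm.pow 2
  have hf2s : HasCompactSupport fun x => ‖cutoff R x • v x‖ ^ 2 := by
    refine HasCompactSupport.intro hχvs fun x hx => ?_
    rw [image_eq_zero_of_notMem_tsupport hx, norm_zero, zero_pow two_ne_zero]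
  have hf : MemLp (fun x => ‖cutoff R x • v x‖ ^ 2) (ENNReal.ofReal 3) volume :=
    hf2c.memLp_of_hasCompactSupport hf2s
  have h32 : ENNReal.ofReal (3 / 2 : ℝ) = 3 / 2 := by
    rw [ENNReal.ofReal_div_of_pos (by norm_num : (0 : ℝ) < 2)]
    norm_num
  have hg : MemLp (fun x => ‖e x‖ ^ 2) (ENNReal.ofReal (3 / 2)) volume := by
    rw [h32]
    have h := he3.norm_rpow_div 2
    simp only [ENNReal.toReal_ofNat, Real.rpow_two] at h
    exact h
  have hH := integral_mul_le_Lp_mul_Lq_of_nonneg hpq (Eventually.of_forall fun x => by positivity)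
    (Eventually.of_forall fun x => by positivity) hf hg
  -- evaluate the right-hand side
  have hI0 : 0 ≤ ∫ x, ‖cutoff R x • v x‖ ^ 6 := integral_nonneg fun x => by positivity
  have hA : (∫ x, (‖cutoff R x • v x‖ ^ 2) ^ (3 : ℝ)) ^ (1 / (3 : ℝ)) =
      ((∫ x, ‖cutoff R x • v x‖ ^ 6) ^ (6 : ℝ)⁻¹) ^ 2 := by
    have h1 : ∀ x, (‖cutoff R x • v x‖ ^ 2) ^ (3 : ℝ) = ‖cutoff R x • v x‖ ^ 6 := fun x => by
      rw [show (3 : ℝ) = ((3 : ℕ) : ℝ) by norm_num, Real.rpow_natCast, ← pow_mul]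
    simp only [h1]
    rw [← Real.rpow_natCast, ← Real.rpow_mul hI0]
    norm_num
  have hN3 : (eLpNorm e 3 volume).toReal = (∫ x, ‖e x‖ ^ (3 : ℝ)) ^ (3 : ℝ)⁻¹ := by
    rw [he3.eLpNorm_eq_integral_rpow_norm (by norm_num) (by norm_num), ENNReal.toReal_ofReal
      (Real.rpow_nonneg (integral_nonneg fun x => by positivity) _)]
    norm_num
  have hE0 : 0 ≤ ∫ x, ‖e x‖ ^ (3 : ℝ) := integral_nonneg fun x => by positivity
  have hB : (∫ x, (‖e x‖ ^ 2) ^ (3 / 2 : ℝ)) ^ (1 / (3 / 2 : ℝ)) = (eLpNorm e 3 volume).toReal ^ 2 := by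
    have h1 : ∀ x, (‖e x‖ ^ 2) ^ (3 / 2 : ℝ) = ‖e x‖ ^ (3 : ℝ) := fun x => by
      rw [show ‖e x‖ ^ 2 = ‖e x‖ ^ (2 : ℝ) by rw [Real.rpow_two], ← Real.rpow_mul (norm_nonneg _)]
      norm_num
    simp only [h1]
    rw [hN3, ← Real.rpow_natCast, ← Real.rpow_mul hE0]
    norm_num
  rw [hA, hB] at hH
  exact hH

/-- **The absorbed term**: for `v ∈ C¹ ∩ L³`, `e ∈ C⁰ ∩ L³`, `R ≥ 1`, `ν > 0`,
`2|∫ φ_R ⟪Dv(v), e⟫| ≤ (2√2 K ‖e‖₃ + ν/4) X + (4/ν) K² ‖e‖₃² · 2(2∫(‖Dχ_R‖|v|)²-bound)`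
with `K` the Gagliardo–Nirenberg–Sobolev constant: this is the term that GIP absorb "using the
fact that `w` is uniformly bounded by `ε₀`" (here: `‖e(t)‖₃` small), after Sobolev embedding
`‖χv‖₆ ≲ ‖D(χv)‖₂` (GIP 2003, proof of Thm. 2.1, p. 1397; Lemarié-Rieusset 2016, p. 516, term `A`).
[cite: GallagherIftimiePlanchon2003, Thm. 2.1 (proof, p. 1397)] -/
theorem abs_absorbed_term_le (hE : Module.finrank ℝ E = 3) {v e : E → E}
    (hv1 : ContDiff ℝ 1 v) (hv3 : MemLp v 3 volume) (he0 : Continuous e) (he3 : MemLp e 3 volume)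
    {R C₁ ν : ℝ} (hR : 1 ≤ R) (hC₁ : ∀ x : E, ‖fderiv ℝ (cutoff R) x‖ ≤ C₁ / R) (hν : 0 < ν) :
    2 * |∫ x, cutoff R x ^ 2 * ⟪fderiv ℝ v x (v x), e x⟫| ≤
      (2 * Real.sqrt 2 * (eLpNormLESNormFDerivOfEqInnerConst (volume : Measure E) 2 : ℝ) *
          (eLpNorm e 3 volume).toReal + ν / 4) *
          (∫ x, cutoff R x ^ 2 * frobeniusNormSq (fderiv ℝ v x)) +
        4 / ν * ((eLpNormLESNormFDerivOfEqInnerConst (volume : Measure E) 2 : ℝ) ^ 2 *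
          (eLpNorm e 3 volume).toReal ^ 2 *
          (2 * (2 * C₁ ^ 2 * ((volume (closedBall (0 : E) 1)) ^ (1 / 3 : ℝ)).toReal / R *
            (eLpNorm v 3 volume ^ 2).toReal))) := by
  have hR0 : 0 < R := one_pos.trans_le hR
  obtain ⟨hfc, hfs, hf2, hfX⟩ := dissipationDensity_props hv1 hR0
  set X : ℝ := ∫ x, cutoff R x ^ 2 * frobeniusNormSq (fderiv ℝ v x) with hX
  set K : ℝ := (eLpNormLESNormFDerivOfEqInnerConst (volume : Measure E) 2 : ℝ) with hK
  set N3e : ℝ := (eLpNorm e 3 volume).toReal with hN3e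
  set bd : ℝ := 2 * C₁ ^ 2 * ((volume (closedBall (0 : E) 1)) ^ (1 / 3 : ℝ)).toReal / R *
    (eLpNorm v 3 volume ^ 2).toReal with hbd
  have hK0 : 0 ≤ K := NNReal.coe_nonneg _
  have hN3e0 : 0 ≤ N3e := ENNReal.toReal_nonneg
  have hX0 : 0 ≤ X := by
    rw [hX]; exact integral_nonneg fun x => mul_nonneg (sq_nonneg _) (frobeniusNormSq_nonneg _)
  have hgbd : ∫ x, (‖fderiv ℝ (cutoff R) x‖ * ‖v x‖) ^ 2 ≤ bd :=
    integral_sq_norm_fderiv_cutoff_mul_norm_le hE hv3 hR hC₁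
  have hbd0 : 0 ≤ bd := le_trans (integral_nonneg fun x => sq_nonneg _) hgbd
  -- the weight `g = χ |v| |e|` and Cauchy–Schwarz
  have hgc : Continuous fun x => cutoff R x * (‖v x‖ * ‖e x‖) :=
    (contDiff_cutoff (n := 1) R).continuous.mul (hv1.continuous.norm.mul he0.norm)
  have hgs : HasCompactSupport fun x => cutoff R x * (‖v x‖ * ‖e x‖) :=
    (hasCompactSupport_cutoff hR0).mul_right
  have hg2 : MemLp (fun x => cutoff R x * (‖v x‖ * ‖e x‖)) 2 volume := hgc.memLp_of_hasCompactSupport hgs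
  have hpt : ∀ x, |cutoff R x ^ 2 * ⟪fderiv ℝ v x (v x), e x⟫| ≤
      (cutoff R x * Real.sqrt (frobeniusNormSq (fderiv ℝ v x))) * (cutoff R x * (‖v x‖ * ‖e x‖)) := by
    intro x
    rw [abs_mul, abs_of_nonneg (sq_nonneg _)]
    have h := abs_inner_fderiv_apply_le (v := v) x (v x) (e x)
    have hχ : 0 ≤ cutoff R x ^ 2 := sq_nonneg _
    calc cutoff R x ^ 2 * |⟪fderiv ℝ v x (v x), e x⟫|
        ≤ cutoff R x ^ 2 * (Real.sqrt (frobeniusNormSq (fderiv ℝ v x)) * ‖v x‖ * ‖e x‖) :=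
          mul_le_mul_of_nonneg_left h hχ
      _ = (cutoff R x * Real.sqrt (frobeniusNormSq (fderiv ℝ v x))) * (cutoff R x * (‖v x‖ * ‖e x‖)) := by
          ring
  have hI : Integrable (fun x => (cutoff R x * Real.sqrt (frobeniusNormSq (fderiv ℝ v x))) *
      (cutoff R x * (‖v x‖ * ‖e x‖))) volume :=
    (hfc.mul hgc).integrable_of_hasCompactSupport hfs.mul_right
  have hCS := integral_mul_le_sqrt_mul_sqrt_of_memLp hf2 hg2
  rw [hfX] at hCS
  -- the weight integral `J = ∫ ‖χv‖² |e|²`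
  have hJeq : ∫ x, (cutoff R x * (‖v x‖ * ‖e x‖)) ^ 2 = ∫ x, ‖cutoff R x • v x‖ ^ 2 * ‖e x‖ ^ 2 := by
    refine integral_congr_ae (Eventually.of_forall fun x => ?_)
    show (cutoff R x * (‖v x‖ * ‖e x‖)) ^ 2 = ‖cutoff R x • v x‖ ^ 2 * ‖e x‖ ^ 2
    rw [norm_smul, Real.norm_of_nonneg (cutoff_nonneg R x)]
    ring
  have hJ : ∫ x, (cutoff R x * (‖v x‖ * ‖e x‖)) ^ 2 ≤ (K * Real.sqrt (2 * X + 2 * bd)) ^ 2 * N3e ^ 2 := by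
    rw [hJeq]
    refine (integral_norm_cutoff_smul_sq_mul_norm_sq_le hv1.continuous he3 hR0).trans ?_
    have hS0 : 0 ≤ (∫ x, ‖cutoff R x • v x‖ ^ 6) ^ (6 : ℝ)⁻¹ :=
      Real.rpow_nonneg (integral_nonneg fun x => by positivity) _
    have hS := rpow_integral_norm_cutoff_smul_pow_six_le hE hv1 hR0
    have hS' : (∫ x, ‖cutoff R x • v x‖ ^ 6) ^ (6 : ℝ)⁻¹ ≤ K * Real.sqrt (2 * X + 2 * bd) := by
      refine hS.trans (mul_le_mul_of_nonneg_left (Real.sqrt_le_sqrt ?_) hK0)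
      linarith
    gcongr
  have hsqrtJ : Real.sqrt (∫ x, (cutoff R x * (‖v x‖ * ‖e x‖)) ^ 2) ≤ K * Real.sqrt (2 * X + 2 * bd) * N3e := by
    rw [Real.sqrt_le_left (by positivity)]
    calc ∫ x, (cutoff R x * (‖v x‖ * ‖e x‖)) ^ 2 ≤ (K * Real.sqrt (2 * X + 2 * bd)) ^ 2 * N3e ^ 2 := hJ
      _ = (K * Real.sqrt (2 * X + 2 * bd) * N3e) ^ 2 := by ring
  -- the basic bound `2|T| ≤ 2 √X · K √(2X + 2bd) · N3e`
  have hT : |∫ x, cutoff R x ^ 2 * ⟪fderiv ℝ v x (v x), e x⟫| ≤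
      Real.sqrt X * (K * Real.sqrt (2 * X + 2 * bd) * N3e) := by
    calc |∫ x, cutoff R x ^ 2 * ⟪fderiv ℝ v x (v x), e x⟫|
        ≤ ∫ x, |cutoff R x ^ 2 * ⟪fderiv ℝ v x (v x), e x⟫| := abs_integral_le_integral_abs
      _ ≤ ∫ x, (cutoff R x * Real.sqrt (frobeniusNormSq (fderiv ℝ v x))) * (cutoff R x * (‖v x‖ * ‖e x‖)) :=
          integral_mono_of_nonneg (Eventually.of_forall fun x => abs_nonneg _) hI
            (Eventually.of_forall hpt)
      _ ≤ Real.sqrt X * Real.sqrt (∫ x, (cutoff R x * (‖v x‖ * ‖e x‖)) ^ 2) := hCS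
      _ ≤ Real.sqrt X * (K * Real.sqrt (2 * X + 2 * bd) * N3e) := by gcongr
  -- `√(2X + 2bd) ≤ √2 √X + √(2bd)` and Young
  have hsplit : Real.sqrt (2 * X + 2 * bd) ≤ Real.sqrt 2 * Real.sqrt X + Real.sqrt (2 * bd) := by
    -- `√(a + b) ≤ √a + √b`
    have hab : Real.sqrt (2 * X + 2 * bd) ≤ Real.sqrt (2 * X) + Real.sqrt (2 * bd) := by
      rw [Real.sqrt_le_left (by positivity)]
      have h1 := Real.sq_sqrt (by positivity : (0 : ℝ) ≤ 2 * X)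
      have h2 := Real.sq_sqrt (by positivity : (0 : ℝ) ≤ 2 * bd)
      nlinarith [Real.sqrt_nonneg (2 * X), Real.sqrt_nonneg (2 * bd),
        mul_nonneg (Real.sqrt_nonneg (2 * X)) (Real.sqrt_nonneg (2 * bd))]
    rwa [Real.sqrt_mul (by norm_num : (0 : ℝ) ≤ 2) X] at hab
  have hY := two_mul_le_young hν (Real.sqrt X) (K * N3e * Real.sqrt (2 * bd))
  rw [Real.sq_sqrt hX0] at hY
  have hb2 : (K * N3e * Real.sqrt (2 * bd)) ^ 2 = K ^ 2 * N3e ^ 2 * (2 * bd) := by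
    rw [mul_pow, mul_pow, Real.sq_sqrt (by positivity)]
  rw [hb2] at hY
  have hsX := Real.sqrt_nonneg X
  have hXX : Real.sqrt X * Real.sqrt X = X := Real.mul_self_sqrt hX0
  calc 2 * |∫ x, cutoff R x ^ 2 * ⟪fderiv ℝ v x (v x), e x⟫|
      ≤ 2 * (Real.sqrt X * (K * Real.sqrt (2 * X + 2 * bd) * N3e)) := by gcongr
    _ ≤ 2 * (Real.sqrt X * (K * (Real.sqrt 2 * Real.sqrt X + Real.sqrt (2 * bd)) * N3e)) := by gcongr
    _ = 2 * Real.sqrt 2 * K * N3e * (Real.sqrt X * Real.sqrt X) +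
          2 * Real.sqrt X * (K * N3e * Real.sqrt (2 * bd)) := by ring
    _ ≤ 2 * Real.sqrt 2 * K * N3e * X + (ν / 4 * X + 4 / ν * (K ^ 2 * N3e ^ 2 * (2 * bd))) := by
        rw [hXX]; gcongr
    _ = (2 * Real.sqrt 2 * K * N3e + ν / 4) * X + 4 / ν * (K ^ 2 * N3e ^ 2 * (2 * bd)) := by ring

end Terms

end GIP2003

end Literature.Analysis.FluidPDE

end
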